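import Summits.QuantumFields.YangMills.Theorems.ColdStartUniversalityLatticeLangevinTimeAverageHoeffding
import Summits.QuantumFields.YangMills.Theorems.ColdStartUniversalityLatticeLangevinDiscreteSamplingHoeffding
import Summits.QuantumFields.YangMills.Theorems.ColdStartUniversalityLatticeLangevinTimeAverageHoeffdingUniform
import Summits.QuantumFields.YangMills.Theorems.ColdStartUniversalityLatticeLangevinLiebRobinsonMixingTime
import HarnessLib

/-!
# Route `ColdStartUniversality` (fixed-cut-off SZZ dynamics): SAMPLE COMPLEXITY OF THE COLD-START LANGEVIN SAMPLER —
# `T ≥ (576C/c)·ε⁻²·log(2/δ)` lattice time (resp. `N ≥ 32g²·ε⁻²·log(2/δ)` samples) gives an `(ε, δ)`-estimate of `μ_(β')(G)` from ONE run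

Helper file (seat `ym-line-csu-p1`, g34; `--supports stmt-QuantumFields-24809`).  The `(ε, δ)` ("PAC") reading of the Hoeffding bounds of files
70, 71 and 74: for every strong solution of the SU(2) SZZ dynamics from a deterministic start on ANY probability space (e.g. the cold start),
* `two_mul_exp_neg_le_of_log_le` — `log(2/δ) ≤ x ⇒ 2e^(−x) ≤ δ`;
* ★★★ `measureReal_timeAverage_deviation_le_of_time_ge` — every continuous `|G| ≤ 1`, `ε > 0`, `0 < δ`: if `T ≥ (576C/c)·log(2/δ)/ε²` then
  `P[|T⁻¹∫_(0,T] G(U_r)dr − μ_(β')(G)| ≥ ε] ≤ δ`;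
* ★★★ `measureReal_average_deviation_le_of_samples_ge` — every bounded measurable `|G| ≤ 1`, step `h > 0`: if `N ≥ 32g²·log(2/δ)/ε²`
  (`g = max(1, C/(1−e^(−ch)))`) then `P[|N⁻¹Σ_(k<N) G(U_(kh)) − μ_(β')(G)| ≥ ε] ≤ δ`;
* ★★★ `measureReal_timeAverage_deviation_le_of_time_ge_uniform` — local `C⁵` observables at `|β'| < 1/12`: `T ≥ (576C_f/ρ)·log(2/δ)/ε²`
  suffices, INDEPENDENTLY OF THE VOLUME (`ρ = 1 − 12|β'|`, `C_f` the local mixing constant).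
THEOREMS ONLY, no definition, no sorry; [folklore].  HONEST FRAMING: fixed cut-off; `C, c` depend on `L, β'`; `UniformColdStartMixing` (24809) is
NOT restated; no crux, rung or summit statement is proved; the Yang–Mills mass gap is NOT proved.
-/

set_option autoImplicit false

noncomputable section

namespace Summit.QuantumFields.YangMills.Theorems.ColdStartUniversality

open MeasureTheory ProbabilityTheory Filter Topology Set
open scoped NNReal ENNReal BigOperators
open Literature Literature.Probability.Process Literature.MathematicalPhysics.QuantumFieldTheory
open Literature.MathematicalPhysics.QuantumFieldTheory.Balaban1983to89
open Literature.MathematicalPhysics.QuantumLattice (fundamentalRep fundamentalLatticeRep continuous_fundamentalRep)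

/-- `log(2/δ) ≤ x` and `0 < δ` give `2·e^(−x) ≤ δ`. [folklore] -/
theorem two_mul_exp_neg_le_of_log_le {δ x : ℝ} (hδ : 0 < δ) (hx : Real.log (2 / δ) ≤ x) : 2 * Real.exp (-x) ≤ δ := by
  have h1 : Real.exp (-x) ≤ Real.exp (-Real.log (2 / δ)) := Real.exp_le_exp.2 (neg_le_neg hx)
  have h2 : Real.exp (-Real.log (2 / δ)) = δ / 2 := by
    rw [Real.exp_neg, Real.exp_log (by positivity), inv_div]
  rw [h2] at h1
  calc 2 * Real.exp (-x) ≤ 2 * (δ / 2) := mul_le_mul_of_nonneg_left h1 zero_le_two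
    _ = δ := by ring

variable {L : ℕ} [NeZero L]

/-- ★★★ **Sample complexity of time averages** (every coupling; `C, c` depend on `L, β'`): there are `C, c > 0` such that for every strong solution
from a deterministic start on ANY space, every continuous `G` with `|G| ≤ 1`, every `ε > 0`, `δ > 0` and every lattice time
`T ≥ (576C/c)·log(2/δ)/ε²` (`T > 0`): `P[|T⁻¹∫_(0,T] G(U_r)dr − ∫ G dμ_(β')| ≥ ε] ≤ δ`. [folklore] -/
theorem measureReal_timeAverage_deviation_le_of_time_ge (L : ℕ) [NeZero L] (β' : ℝ) :
    ∃ C c : ℝ, 0 < C ∧ 0 < c ∧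
      ∀ (x : GaugeConfig 3 L (Matrix.specialUnitaryGroup (Fin 2) ℂ))
        (Ω : Type) [MeasurableSpace Ω] (P : Measure Ω) [IsProbabilityMeasure P]
        (W : ℝ≥0 → Ω → (Edge 3 L × NoiseIdx 2 → ℝ)) (hW : IsFlatBrownian W P)
        (U : ℝ≥0 → Ω → GaugeConfig 3 L (Matrix.specialUnitaryGroup (Fin 2) ℂ)),
        (∀ ω, U 0 ω = x) →
        (latticeLangevinDynamics (fundamentalLatticeRep 2) β').IsSolution (fundamentalRep (Fin 2)) hW.natFiltration P W U →
        ∀ (G : GaugeConfig 3 L (Matrix.specialUnitaryGroup (Fin 2) ℂ) → ℝ), Continuous G → (∀ z, |G z| ≤ 1) →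
        ∀ (ε : ℝ), 0 < ε → ∀ (δ : ℝ), 0 < δ → ∀ (T : ℝ), 0 < T → 576 * C / c * Real.log (2 / δ) / ε ^ 2 ≤ T →
          P.real {ω | ε ≤ |T⁻¹ * (∫ r in Ioc 0 T, G (U r.toNNReal ω)) - ∫ z, G z ∂(wilsonMeasure (d := 3) (L := L) (fundamentalRep (Fin 2)) β')|} ≤ δ := by
  obtain ⟨C, c, hC, hc, h⟩ := measureReal_timeAverage_deviation_le_exp L β'
  refine ⟨C, c, hC, hc, fun x Ω _ P _ W hW U hU0 hU G hG hG1 ε hε δ hδ T hT hTge => ?_⟩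
  refine (h x Ω P W hW U hU0 hU G hG hG1 T hT ε hε).trans ?_
  rw [neg_div]
  refine two_mul_exp_neg_le_of_log_le hδ ?_
  rw [le_div_iff₀ (by positivity)]
  have h1 := mul_le_mul_of_nonneg_right hTge (by positivity : (0 : ℝ) ≤ c * ε ^ 2)
  calc Real.log (2 / δ) * (576 * C) = 576 * C / c * Real.log (2 / δ) / ε ^ 2 * (c * ε ^ 2) := by field_simp
    _ ≤ T * (c * ε ^ 2) := h1
    _ = c * T * ε ^ 2 := by ring

/-- ★★★ **Sample complexity of discrete samples** (every coupling; `C, c` depend on `L, β'`): there are `C, c > 0` such that for every strong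
solution from a deterministic start, every measurable `G` with `|G| ≤ 1`, every step `h > 0`, `ε > 0`, `δ > 0`, with `g = max(1, C/(1−e^(−ch)))`,
every `N ≥ 32g²·log(2/δ)/ε²`: `P[|N⁻¹Σ_(k<N) G(U_(kh)) − ∫ G dμ_(β')| ≥ ε] ≤ δ`. [folklore] -/
theorem measureReal_average_deviation_le_of_samples_ge (L : ℕ) [NeZero L] (β' : ℝ) :
    ∃ C c : ℝ, 0 < C ∧ 0 < c ∧
      ∀ (x : GaugeConfig 3 L (Matrix.specialUnitaryGroup (Fin 2) ℂ))
        (Ω : Type) [MeasurableSpace Ω] (P : Measure Ω) [IsProbabilityMeasure P]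
        (W : ℝ≥0 → Ω → (Edge 3 L × NoiseIdx 2 → ℝ)) (hW : IsFlatBrownian W P)
        (U : ℝ≥0 → Ω → GaugeConfig 3 L (Matrix.specialUnitaryGroup (Fin 2) ℂ)),
        (∀ ω, U 0 ω = x) →
        (latticeLangevinDynamics (fundamentalLatticeRep 2) β').IsSolution (fundamentalRep (Fin 2)) hW.natFiltration P W U →
        ∀ (G : GaugeConfig 3 L (Matrix.specialUnitaryGroup (Fin 2) ℂ) → ℝ), Measurable G → (∀ z, |G z| ≤ 1) →
        ∀ (h : ℝ≥0), 0 < h → ∀ (ε : ℝ), 0 < ε → ∀ (δ : ℝ), 0 < δ → ∀ (N : ℕ),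
          32 * max 1 (C / (1 - Real.exp (-c * h))) ^ 2 * Real.log (2 / δ) / ε ^ 2 ≤ N →
          P.real {ω | ε ≤ |(N : ℝ)⁻¹ * (∑ k ∈ Finset.range N, G (U ((k : ℝ≥0) * h) ω)) -
              ∫ z, G z ∂(wilsonMeasure (d := 3) (L := L) (fundamentalRep (Fin 2)) β')|} ≤ δ := by
  obtain ⟨C, c, hC, hc, hF⟩ := measureReal_average_deviation_le_exp L β'
  refine ⟨C, c, hC, hc, fun x Ω _ P _ W hW U hU0 hU G hG hG1 h hh ε hε δ hδ N hNge => ?_⟩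
  refine (hF x Ω P W hW U hU0 hU G hG hG1 h hh N ε hε).trans ?_
  set g : ℝ := max 1 (C / (1 - Real.exp (-c * h))) with hg
  have hg0 : 0 < g := one_pos.trans_le (le_max_left _ _)
  rw [neg_div]
  refine two_mul_exp_neg_le_of_log_le hδ ?_
  rw [le_div_iff₀ (by positivity)]
  have h1 := mul_le_mul_of_nonneg_right hNge (by positivity : (0 : ℝ) ≤ ε ^ 2)
  calc Real.log (2 / δ) * (32 * g ^ 2) = 32 * g ^ 2 * Real.log (2 / δ) / ε ^ 2 * ε ^ 2 := by field_simp
    _ ≤ N * ε ^ 2 := h1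

/-- ★★★ **VOLUME-FREE sample complexity for local observables at strong coupling.**  At `|β'| < 1/12`, for every torus size `L`, every strong
solution from a deterministic start on ANY space, every `C⁵` local observable `f` (link-Lipschitz profile `ℓ ≥ 0` supported in `Λ`, `|f∘coords| ≤ 1`),
`ε > 0`, `δ > 0`, and every `T ≥ (576·C_f/ρ)·log(2/δ)/ε²` (`ρ = 1 − 12|β'|`, `C_f = 12π#Λ√(Σℓ²)(6(7+6λ/ρ)³+2)`):
`P[|T⁻¹∫_(0,T] f∘coords(U_r)dr − μ_(β')(f∘coords)| ≥ ε] ≤ δ` — a run length independent of the volume. [folklore] -/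
theorem measureReal_timeAverage_deviation_le_of_time_ge_uniform (L : ℕ) [NeZero L] (β' : ℝ) (hβ : |β'| < 1 / 12)
    (x : GaugeConfig 3 L (Matrix.specialUnitaryGroup (Fin 2) ℂ))
    {Ω : Type} [MeasurableSpace Ω] {P : Measure Ω} [IsProbabilityMeasure P]
    {W : ℝ≥0 → Ω → (Edge 3 L × NoiseIdx 2 → ℝ)} (hW : IsFlatBrownian W P)
    {U : ℝ≥0 → Ω → GaugeConfig 3 L (Matrix.specialUnitaryGroup (Fin 2) ℂ)} (hU0 : ∀ ω, U 0 ω = x)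
    (hU : (latticeLangevinDynamics (fundamentalLatticeRep 2) β').IsSolution (fundamentalRep (Fin 2)) hW.natFiltration P W U)
    {f : (Edge 3 L × Fin 2 × Fin 2 × Bool → ℝ) → ℝ} (hf : ContDiff ℝ 5 f) (Λ : Finset (Edge 3 L)) {ℓ : Edge 3 L → ℝ} (hℓ : ∀ e, 0 ≤ ℓ e)
    (hℓΛ : ∀ e, e ∉ Λ → ℓ e = 0) {ε : ℝ} (hε : 0 < ε) {δ : ℝ} (hδ : 0 < δ) {T : ℝ} (hT : 0 < T)
    (hTge : 576 * (12 * Real.pi * Λ.card * Real.sqrt (∑ e : Edge 3 L, ℓ e ^ 2) * (6 * (7 + 6 * ((1300 + 4 * Real.sqrt 2) * |β'|) / (1 - 12 * |β'|)) ^ 3 + 2)) /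
      (1 - 12 * |β'|) * Real.log (2 / δ) / ε ^ 2 ≤ T) :
    let coords : GaugeConfig 3 L (Matrix.specialUnitaryGroup (Fin 2) ℂ) → (Edge 3 L × Fin 2 × Fin 2 × Bool → ℝ) :=
      fun V q => (fun z : ℂ => if q.2.2.2 then z.im else z.re)
        ((fundamentalRep (Fin 2) (V q.1) : Matrix (Fin 2) (Fin 2) ℂ) q.2.1 q.2.2.1)
    (∀ (e : Edge 3 L) (y y' : (GaugeConfig 3 L (Matrix.specialUnitaryGroup (Fin 2) ℂ))), (∀ g, g ≠ e → y g = y' g) →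
      |f (coords y) - f (coords y')| ≤ ℓ e * frobNorm ((y e : Matrix (Fin 2) (Fin 2) ℂ) - (y' e : Matrix (Fin 2) (Fin 2) ℂ))) →
    (∀ y, |f (coords y)| ≤ 1) →
    P.real {ω | ε ≤ |T⁻¹ * (∫ r in Ioc 0 T, f (coords (U r.toNNReal ω))) -
        ∫ y, f (coords y) ∂(wilsonMeasure (d := 3) (L := L) (fundamentalRep (Fin 2)) β')|} ≤ δ := by
  intro coords hLip hf1
  classical
  haveI := secondCountableTopology_su2
  haveI := borelSpace_config L
  have hρ : 0 < 1 - 12 * |β'| := by linarith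
  set Cf : ℝ := 12 * Real.pi * Λ.card * Real.sqrt (∑ e : Edge 3 L, ℓ e ^ 2) *
    (6 * (7 + 6 * ((1300 + 4 * Real.sqrt 2) * |β'|) / (1 - 12 * |β'|)) ^ 3 + 2) with hCf
  have hlam : 0 ≤ (1300 + 4 * Real.sqrt 2) * |β'| / (1 - 12 * |β'|) := div_nonneg (by positivity) hρ.le
  have hKB : 0 ≤ 6 * (7 + 6 * ((1300 + 4 * Real.sqrt 2) * |β'|) / (1 - 12 * |β'|)) ^ 3 + 2 := by
    have h7 : 0 ≤ (7 + 6 * ((1300 + 4 * Real.sqrt 2) * |β'|) / (1 - 12 * |β'|)) ^ 3 := by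
      apply pow_nonneg
      have : 0 ≤ 6 * ((1300 + 4 * Real.sqrt 2) * |β'|) / (1 - 12 * |β'|) := by
        rw [mul_div_assoc]; exact mul_nonneg (by norm_num) hlam
      linarith
    linarith
  have hCf0 : 0 ≤ Cf := by rw [hCf]; exact mul_nonneg (by positivity) hKB
  set m : ℝ := ∫ y, f (coords y) ∂(wilsonMeasure (d := 3) (L := L) (fundamentalRep (Fin 2)) β') with hm
  rcases eq_or_lt_of_le hCf0 with hz | hpos
  · -- degenerate profile `C_f = 0`: the observable is constant (`κ_0 = id` in the volume-free mixing bound), the event is empty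
    obtain ⟨κ, hκM, hκ0, hreal⟩ := exists_transitionKernel L β'
    haveI := hκM
    have hco : Continuous coords := continuous_coords (L := L)
    have hGc : Continuous fun y : (GaugeConfig 3 L (Matrix.specialUnitaryGroup (Fin 2) ℂ)) => f (coords y) := hf.continuous.comp hco
    have hconst : ∀ y : (GaugeConfig 3 L (Matrix.specialUnitaryGroup (Fin 2) ℂ)), f (coords y) = m := by
      intro y
      have h0 := LiebRobinson.wilson_local_mixing_halfRate_of_linkLipschitz L β' hβ κ hreal hf Λ hℓ hℓΛ 0 hLip y
      have hR : 12 * Real.pi * Λ.card * Real.sqrt (∑ e : Edge 3 L, ℓ e ^ 2) *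
          (6 * (7 + 6 * ((1300 + 4 * Real.sqrt 2) * |β'|) / (1 - 12 * |β'|)) ^ 3 + 2) * Real.exp (-((1 - 12 * |β'|) / 2 * ((0 : ℝ≥0) : ℝ))) = 0 := by
        rw [← hCf, ← hz, zero_mul]
      have h1 : |(∫ z, f (coords z) ∂(κ 0 y)) - m| ≤ 0 := by rw [← hR]; exact h0
      have h2 : (∫ z, f (coords z) ∂(κ 0 y)) = f (coords y) := by
        rw [hκ0, Kernel.id_apply]
        exact integral_dirac' _ _ hGc.measurable.stronglyMeasurable
      have h3 := abs_nonpos_iff.1 h1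
      rw [h2] at h3
      linarith
    have hempty : {ω | ε ≤ |T⁻¹ * (∫ r in Ioc 0 T, f (coords (U r.toNNReal ω))) - m|} = ∅ := by
      refine Set.eq_empty_iff_forall_notMem.2 fun ω hω => ?_
      simp only [Set.mem_setOf_eq, hconst, setIntegral_const, smul_eq_mul, Real.volume_real_Ioc_of_le hT.le, sub_zero] at hω
      rw [← mul_assoc, inv_mul_cancel₀ hT.ne', one_mul, sub_self, abs_zero] at hω
      linarith
    rw [hempty, measureReal_empty]
    exact hδ.le
  · have hmain := LiebRobinson.measureReal_timeAverage_deviation_le_exp_uniform_of_linkLipschitz L β' hβ x hW hU0 hU hf Λ hℓ hℓΛ hT hε hLip hf1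
    refine hmain.trans ?_
    rw [neg_div]
    refine two_mul_exp_neg_le_of_log_le hδ ?_
    rw [le_div_iff₀ (by positivity)]
    have h1 := mul_le_mul_of_nonneg_right hTge (by positivity : (0 : ℝ) ≤ (1 - 12 * |β'|) * ε ^ 2)
    calc Real.log (2 / δ) * (576 * Cf) = 576 * Cf / (1 - 12 * |β'|) * Real.log (2 / δ) / ε ^ 2 * ((1 - 12 * |β'|) * ε ^ 2) := by
          field_simp
      _ ≤ T * ((1 - 12 * |β'|) * ε ^ 2) := h1
      _ = (1 - 12 * |β'|) * T * ε ^ 2 := by ring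

end Summit.QuantumFields.YangMills.Theorems.ColdStartUniversality

end
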